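import Literature.IUT.HodgeArakelov.BadPrimeGaussianMonoidsCor36GenuineRecordFamily
import Literature.IUT.HodgeArakelov.BadPrimeGaussianMonoidsLabelwiseAct

/-!
# [IUTchII] Cor 3.6 (ii) «↷» at the genuine `θ_env` data of `X̲̲_K` for ANY family of inversion actions, `Ψ`-level (exact) and
# `∞`-level (up to torsion), with the labelled copies identified through EQUALITY OF COEFFICIENT ACTIONS
# (repair of GAP-LEDGER G-w4d004-1, part 9: abc-iut-w5-d192's family theorems p436301 §2–§3 re-pointed; proof-only)

S. Mochizuki, *Inter-universal Teichmüller theory II*, kurims Dec-2020 manuscript, Cor 3.6 (i) p. 99 l. 40–47, Cor 3.6 (ii) p. 100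
l. 23–26 («Thus, each monoid `Ψ_{Fξ}(†F_v)` is equipped with a natural action by `G_v(M^Θ_*▶)_{⟨F_l^⋇⟩}`»), Cor 3.5 (i)/(ii) pp. 94–95
(«the inclusions `G_v(M^Θ_*) ↪ Π_{v▶}(M^Θ_*▶)` determined by the various choices of the `D^δ_{t,μ_-}`»), Rmk 3.6.1 p. 101
[cite: Mochizuki2012, Cor 3.6 (ii) p.100]; classically [cite: NeukirchSchmidtWingberg2008, II §7]. Claim key DISPUTED (D-0012); nothing
disputed is asserted here. PROOF-ONLY companion (abc-iut cell, layer L6, seat abc-iut-w4-d004 gen 4; node **IUTchII:Cor3.6(ii)** «↷»,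
sub-DAG row Cor-36.ii.r9; finding F-w4d004-g4-1 / GAP-LEDGER G-w4d004-1). NO definition, NO `Prop` fact, NO instance.

The three theorems are abc-iut-w5-d192's `kummer_smul_restriction_eq_toRecord_family`, `cor36ii_psi_toRecord_family_of_mem_thetaEnv`,
`cor36ii_infty_toRecord_family_of_mem_thetaEnv` (p436301 §2–§3) VERBATIM except that the restriction of label `t` is pinned to the
action-level pull-back `h1LimComapAct … (s_t) … φ₀ (hφAct t)` (abc-iut-w4-d004 `CohomologyLimitComapAct`, p444771) under
`hφAct : ∀ t g (a : l·Δ_Θ), conj(phi(s_t g)) a = conj(φ₀ g) a` — equality of coefficient ACTIONS, which HOLDS at the genuine data for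
every family of sections of `ε` over a common map (`EtaleLevels.hφAct_of_aug_eq`, p445588) — in place of the homomorphism equality
`hφ : ∀ t, phi ∘ s_t = φ₀` that print's configuration with ≥ 2 distinct labels cannot meet; the Cor 3.5 (ii) junctions are the `_act`
twins of `…LabelwiseAct` (p446564): **`kummer_smul_restriction_eq_toRecord_act_family`**, **`cor36ii_psi_toRecord_act_family_of_mem_thetaEnv`**,
**`cor36ii_infty_toRecord_act_family_of_mem_thetaEnv`**. p436301 §1 (`constantMonoid_stable…`, `units_stable…`, `hsat…`, `hThetaU…`,
label-free) is consumed BY NAME. HONEST FRAMING: no side taken on [IUTchIII] Cor 3.12; typed ≠ proved ≠ endorsed.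
-/

noncomputable section

namespace Literature.IUT.HodgeArakelov

namespace EtaleLevels

open Literature.AnabelianGeometry.EtaleTheta CohomologySystemOfContH1 EtaleThetaDataOfSetting TemperedThetaMonoids
  BadPrimeGaussianMonoids

variable {p : ℕ} [Fact p.Prime] {D : Literature.AnabelianGeometry.EtaleTheta.ThetaSetting p}
  {E : D.EtaleThetaData} {l : ℕ} (C : E.DoubleUnderline l) (hC : D.Compat) (hS : D.Sec2Hyps)
  (hl : l.Prime) (hp2 : p ≠ 2) (hpl : p ≠ l) (hζ : ∃ ζ : D.K, IsPrimitiveRoot ζ (4 * l))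
  (mods : ∀ M : ℕ+, D.CyclotomeMod l M)
  (f : contCocycles D.toTheta D.DeltaTheta C.GtpYdduu) (hf : f ∈ C.rootCocycles hC)
  (hmods : ∀ (M M' : ℕ+) (h : (M : ℕ) ∣ (M' : ℕ)) (x : D.lDeltaTheta l),
    MuN.red p M M' h ((mods M').red x) = (mods M).red x)
  (h15 : Literature.AnabelianGeometry.EtaleTheta.ThetaSetting.Prop15iii E hC) (L : C.CuspLabels)
  (hZ : ∀ M : ℕ+, Nonempty (ModelCyclotomes.lDeltaQuot (C.rigidData (mods M) hC hS h15 L) ≃*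
    Literature.IUT.HodgeTheaters.ZHat))
  (hcharY : EtaleThetaDataOfSetting.PiYddCharacteristic C)
  (hlim : Function.Bijective (rigidLimHom C hC hS hl hp2 hpl hζ mods f hf hmods h15 L hZ))
  [(EtaleThetaDataOfSetting.PiYdd C).Normal]
  {A : Type} [CommGroup A] [MulDistribMulAction (Pi C) A] [TopologicalSpace A] [RootableBy A ℕ]
  (c : CyclotomeCoefficients (phi C) (D.lDeltaTheta l) A)
  (hA : ∀ b : A, IsOpen (MulAction.stabilizer (Pi C) b : Set (Pi C)))
  (hfi : ∀ b : A, (MulAction.stabilizer (Pi C) b).FiniteIndex)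
  (O : Submonoid A) (hO : ∀ (σ : Pi C) (b : A), b ∈ O → σ • b ∈ O)
  {Iota : Type}
  (iota : Iota → ((thetaEnvData C hC hS hl hp2 hpl hζ mods f hf hmods h15 L hZ hcharY hlim).D.coh.lim ≃+
    (thetaEnvData C hC hS hl hp2 hpl hζ mods f hf hmods h15 L hZ hcharY hlim).D.coh.lim))
  {Lbl : Type*} {P₀ : TopGroup.{0}} (φ₀ : P₀ →* D.GtpTheta) (s : Lbl → (P₀ →* Pi C))
  (hι : ∀ t, Continuous ((MonoidHom.id (Pi C)).comp (s t)))
  (hN : ∀ t, (⊤ : Subgroup P₀).map ((MonoidHom.id (Pi C)).comp (s t)) ≤ PiYdd C)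
  -- THE ACTION-LEVEL JUNCTION (replaces `hφ : ∀ t, (phi C).comp (s t) = φ₀`)
  (hφAct : ∀ (t : Lbl) (g : P₀) (a : D.lDeltaTheta l),
    MulAut.conjNormal (phi C (((MonoidHom.id (Pi C)).comp (s t)) g)) a = MulAut.conjNormal (φ₀ g) a)

/-! ### §2. `Ψ`-level «↷», exact — any inversion family -/

/-- **The labeled Kummer maps `f_t := R_t ∘ κ : O → lim H¹(Π₀ ∩ ·, l·Δ_Θ)_{φ₀}` are `G_v`-EQUIVARIANT** for the record with ANY
inversion family ([IUTchII] Cor 3.6 (i) p. 99 l. 40–47: `G_v(M^Θ_*▶)_t ↷ (Ψ_{†C_v})_t ⥲ Ψ_cns(M^Θ_*)_t` «compatible with the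
respective conjugation actions»), restrictions pinned to the ACTION-LEVEL pull-back `h1LimComapAct`: abc-iut-w4-d007 `h1LimKummerOn_smul` +
abc-iut-w4-d004 `restriction_conj_section_eq_labelwise_act`.
[cite: Mochizuki2012, Cor 3.6 (i) p.99] -/
theorem kummer_smul_restriction_eq_toRecord_act_family
    (R : Lbl → (((thetaEnvData C hC hS hl hp2 hpl hζ mods f hf hmods h15 L hZ hcharY hlim).toRecord
        (h1LimConjMulAut (phi C) (D.lDeltaTheta l) (PiYdd C)) (h1LimKummerOn (phi C) (D.lDeltaTheta l) (PiYdd C) c hA hfi O)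
        iota).H →*
      Multiplicative (h1Lim φ₀ (D.lDeltaTheta l) (⊤ : Subgroup P₀) ⊥)))
    (hR : ∀ t y, Multiplicative.toAdd (R t y) =
      h1LimComapAct (phi C) (D.lDeltaTheta l) ((MonoidHom.id (Pi C)).comp (s t)) (hι t) φ₀ (hφAct t) (hN t)
        (AddEquiv.additiveMultiplicative (h1Lim (phi C) (D.lDeltaTheta l) (PiYdd C) ⊥) (Additive.ofMul y)))
    (t : Lbl) (g : P₀) (o : O) :
    R t (h1LimKummerOn (phi C) (D.lDeltaTheta l) (PiYdd C) c hA hfi O ⟨(s t g) • (o : A), hO (s t g) (o : A) o.2⟩) =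
      h1LimConjMulAut φ₀ (D.lDeltaTheta l) ⊤ g (R t (h1LimKummerOn (phi C) (D.lDeltaTheta l) (PiYdd C) c hA hfi O o)) := by
  have h1 : h1LimKummerOn (phi C) (D.lDeltaTheta l) (PiYdd C) c hA hfi O ⟨(s t g) • (o : A), hO (s t g) (o : A) o.2⟩ =
      ((thetaEnvData C hC hS hl hp2 hpl hζ mods f hf hmods h15 L hZ hcharY hlim).toRecord
        (h1LimConjMulAut (phi C) (D.lDeltaTheta l) (PiYdd C)) (h1LimKummerOn (phi C) (D.lDeltaTheta l) (PiYdd C) c hA hfi O)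
        iota).conj (s t g)
        (h1LimKummerOn (phi C) (D.lDeltaTheta l) (PiYdd C) c hA hfi O o) :=
    h1LimKummerOn_smul (phi C) (D.lDeltaTheta l) (PiYdd C) c hA hfi O (s t g) o _ rfl
  rw [h1]
  exact restriction_conj_section_eq_labelwise_act
    ((thetaEnvData C hC hS hl hp2 hpl hζ mods f hf hmods h15 L hZ hcharY hlim).toRecord
        (h1LimConjMulAut (phi C) (D.lDeltaTheta l) (PiYdd C)) (h1LimKummerOn (phi C) (D.lDeltaTheta l) (PiYdd C) c hA hfi O)
        iota)
    (phi C) φ₀ (D.lDeltaTheta l) (PiYdd C) (MonoidHom.id (Pi C))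
    (AddEquiv.additiveMultiplicative (h1Lim (phi C) (D.lDeltaTheta l) (PiYdd C) ⊥)) s hι hN hφAct (fun _ _ => rfl) R hR t g _

/-- **[IUTchII] Cor 3.6 (ii) «↷», `Ψ`-LEVEL, EXACT, at the genuine `θ_env` data with ANY inversion family `iota`** (p. 100 l. 23–26
«each monoid `Ψ_{Fξ}(†F_v)` is equipped with a natural action by `G_v(M^Θ_*▶)_{⟨F_l^⋇⟩}`»), the copies `(Ψ_{†C_v})_t` read as `O`:
for every `θ ∈ θ^{i₀}_env(𝕄_*)` and every tuple `x : Lbl → O` whose labeled Kummer classes `(R_t κ(x_t))_t` lie in the Gaussian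
monoid `Ψ_ξ(θ) = ∏ R_t(M^×_TM · θ^ℕ)`, the translated tuple `(s_t(g) · x_t)_t` has the same property. Inputs = the evaluation-
sections data (ACTION-LEVEL junction `hφAct`) + model data; the Cor 3.5 (ii) junction is abc-iut-w4-d004's
`mrange_pi_diagonalStable'_toRecord_act_of_mem_thetaEnv`.
[cite: Mochizuki2012, Cor 3.6 (ii) p.100] -/
theorem cor36ii_psi_toRecord_act_family_of_mem_thetaEnv
    {K : Type*} [Group K] (q : Pi C →* K) (hq : ∀ x : Pi C, q x = 1 → ∀ a ∈ O, x • a = a) (w : P₀ →* K)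
    (hsec : ∀ t g, q (s t g) = w g) {i₀ : Iota}
    {θ : ((thetaEnvData C hC hS hl hp2 hpl hζ mods f hf hmods h15 L hZ hcharY hlim).toRecord
        (h1LimConjMulAut (phi C) (D.lDeltaTheta l) (PiYdd C)) (h1LimKummerOn (phi C) (D.lDeltaTheta l) (PiYdd C) c hA hfi O)
        iota).H}
    (hθ : θ ∈ ((thetaEnvData C hC hS hl hp2 hpl hζ mods f hf hmods h15 L hZ hcharY hlim).toRecord
        (h1LimConjMulAut (phi C) (D.lDeltaTheta l) (PiYdd C)) (h1LimKummerOn (phi C) (D.lDeltaTheta l) (PiYdd C) c hA hfi O)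
        iota).thetaEnv i₀)
    (R : Lbl → (((thetaEnvData C hC hS hl hp2 hpl hζ mods f hf hmods h15 L hZ hcharY hlim).toRecord
        (h1LimConjMulAut (phi C) (D.lDeltaTheta l) (PiYdd C)) (h1LimKummerOn (phi C) (D.lDeltaTheta l) (PiYdd C) c hA hfi O)
        iota).H →*
      Multiplicative (h1Lim φ₀ (D.lDeltaTheta l) (⊤ : Subgroup P₀) ⊥)))
    (hR : ∀ t y, Multiplicative.toAdd (R t y) =
      h1LimComapAct (phi C) (D.lDeltaTheta l) ((MonoidHom.id (Pi C)).comp (s t)) (hι t) φ₀ (hφAct t) (hN t)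
        (AddEquiv.additiveMultiplicative (h1Lim (phi C) (D.lDeltaTheta l) (PiYdd C) ⊥) (Additive.ofMul y)))
    (t₀ : Lbl) (g : P₀) {x : Lbl → O}
    (hx : (fun t => R t (h1LimKummerOn (phi C) (D.lDeltaTheta l) (PiYdd C) c hA hfi O (x t))) ∈
      MonoidHom.mrange (MonoidHom.pi fun t => (R t).comp (splitMonoid
        ((thetaEnvData C hC hS hl hp2 hpl hζ mods f hf hmods h15 L hZ hcharY hlim).toRecord
        (h1LimConjMulAut (phi C) (D.lDeltaTheta l) (PiYdd C)) (h1LimKummerOn (phi C) (D.lDeltaTheta l) (PiYdd C) c hA hfi O)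
        iota).units
        (Submonoid.powers θ)).subtype)) :
    (fun t => R t (h1LimKummerOn (phi C) (D.lDeltaTheta l) (PiYdd C) c hA hfi O
        ⟨(s t g) • ((x t : O) : A), hO (s t g) _ (x t).2⟩)) ∈
      MonoidHom.mrange (MonoidHom.pi fun t => (R t).comp (splitMonoid
        ((thetaEnvData C hC hS hl hp2 hpl hζ mods f hf hmods h15 L hZ hcharY hlim).toRecord
        (h1LimConjMulAut (phi C) (D.lDeltaTheta l) (PiYdd C)) (h1LimKummerOn (phi C) (D.lDeltaTheta l) (PiYdd C) c hA hfi O)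
        iota).units
        (Submonoid.powers θ)).subtype) := by
  have key : (fun t => R t (h1LimKummerOn (phi C) (D.lDeltaTheta l) (PiYdd C) c hA hfi O
      ⟨(s t g) • ((x t : O) : A), hO (s t g) _ (x t).2⟩)) =
      piIso Lbl (h1LimConjMulAut φ₀ (D.lDeltaTheta l) ⊤ g)
        (fun t => R t (h1LimKummerOn (phi C) (D.lDeltaTheta l) (PiYdd C) c hA hfi O (x t))) := by
    funext t
    exact kummer_smul_restriction_eq_toRecord_act_family C hC hS hl hp2 hpl hζ mods f hf hmods h15 L hZ hcharY hlim c hA hfi O hO iota φ₀ s hι hN hφAct R hR t g (x t)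
  rw [key]
  exact mem_of_map_piIso_eq
    (mrange_pi_diagonalStable'_toRecord_act_of_mem_thetaEnv C hC hS hl hp2 hpl hζ mods f hf hmods h15 L hZ hcharY hlim c hA hfi O hO iota φ₀ s hι
      hN hφAct q hq w hsec hθ R hR t₀ g) hx

/-! ### §3. `∞`-level «↷», faithful form up to torsion — any inversion family -/

/-- **[IUTchII] Cor 3.6 (ii) «↷», `∞`-LEVEL, FAITHFUL FORM UP TO TORSION, at the genuine `θ_env` data with ANY inversion family
`iota`** (p. 100 `∞`-row with Cor 3.5 (ii) p. 95 bracket l. 3–7 and Rmk 3.6.1 p. 101), the copies read as `O`: for every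
`θ ∈ θ^{i₀}_env(𝕄_*)`, every label `i` with print's root condition `hroots` on `∞θ^{i}_env` relative to `θ`, and every tuple
`y : Lbl → O` whose labeled Kummer classes lie in `∏ R_t(∞Ψ^{i}_env)`, the translated tuple `(s_t(g) · y_t)_t` lies there again UP
TO a family `(v_t)_t` of ROOTS OF UNITY of `O`. Inputs = sections data + model data (`hc`, `hO`, `hOtors`, `hOroot`) + `hroots`;
the junctions are abc-iut-w4-d004's `pi_restriction_inftyThetaMonoid_upToTorsion_toRecord_act_of_mem_thetaEnv` (ACTION-LEVEL `hφAct`), p436301 §1's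
`hThetaU_toRecord_family`, abc-iut-w5-d131's `splitMonoid_closure_conjStable`, and the torsion classes are Kummer classes of
roots of unity (abc-iut-w5-d098). [cite: Mochizuki2012, Cor 3.6 (ii) p.100] -/
theorem cor36ii_infty_toRecord_act_family_of_mem_thetaEnv (hc : Function.Bijective c.hom)
    (hOtors : ∀ a : A, IsOfFinOrder a → a ∈ O ∧ a⁻¹ ∈ O)
    (hOroot : ∀ (a : A) (n : ℕ), 0 < n → a ^ n ∈ O → a ∈ O)
    {K : Type*} [Group K] (q : Pi C →* K) (hq : ∀ x : Pi C, q x = 1 → ∀ a ∈ O, x • a = a) (w : P₀ →* K)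
    (hsec : ∀ t g, q (s t g) = w g) {i₀ : Iota}
    {θ : ((thetaEnvData C hC hS hl hp2 hpl hζ mods f hf hmods h15 L hZ hcharY hlim).toRecord
        (h1LimConjMulAut (phi C) (D.lDeltaTheta l) (PiYdd C)) (h1LimKummerOn (phi C) (D.lDeltaTheta l) (PiYdd C) c hA hfi O)
        iota).H}
    (hθ : θ ∈ ((thetaEnvData C hC hS hl hp2 hpl hζ mods f hf hmods h15 L hZ hcharY hlim).toRecord
        (h1LimConjMulAut (phi C) (D.lDeltaTheta l) (PiYdd C)) (h1LimKummerOn (phi C) (D.lDeltaTheta l) (PiYdd C) c hA hfi O)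
        iota).thetaEnv i₀)
    (i : ((thetaEnvData C hC hS hl hp2 hpl hζ mods f hf hmods h15 L hZ hcharY hlim).toRecord
        (h1LimConjMulAut (phi C) (D.lDeltaTheta l) (PiYdd C)) (h1LimKummerOn (phi C) (D.lDeltaTheta l) (PiYdd C) c hA hfi O)
        iota).Iota)
    (hroots : ∀ ϑ ∈ ((thetaEnvData C hC hS hl hp2 hpl hζ mods f hf hmods h15 L hZ hcharY hlim).toRecord
        (h1LimConjMulAut (phi C) (D.lDeltaTheta l) (PiYdd C)) (h1LimKummerOn (phi C) (D.lDeltaTheta l) (PiYdd C) c hA hfi O)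
        iota).inftyThetaEnv i,
      ∃ n : ℕ, 0 < n ∧ ϑ ^ n ∈
        splitMonoid ((thetaEnvData C hC hS hl hp2 hpl hζ mods f hf hmods h15 L hZ hcharY hlim).toRecord
        (h1LimConjMulAut (phi C) (D.lDeltaTheta l) (PiYdd C)) (h1LimKummerOn (phi C) (D.lDeltaTheta l) (PiYdd C) c hA hfi O)
        iota).units
          (Submonoid.powers θ))
    (R : Lbl → (((thetaEnvData C hC hS hl hp2 hpl hζ mods f hf hmods h15 L hZ hcharY hlim).toRecord
        (h1LimConjMulAut (phi C) (D.lDeltaTheta l) (PiYdd C)) (h1LimKummerOn (phi C) (D.lDeltaTheta l) (PiYdd C) c hA hfi O)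
        iota).H →*
      Multiplicative (h1Lim φ₀ (D.lDeltaTheta l) (⊤ : Subgroup P₀) ⊥)))
    (hR : ∀ t y, Multiplicative.toAdd (R t y) =
      h1LimComapAct (phi C) (D.lDeltaTheta l) ((MonoidHom.id (Pi C)).comp (s t)) (hι t) φ₀ (hφAct t) (hN t)
        (AddEquiv.additiveMultiplicative (h1Lim (phi C) (D.lDeltaTheta l) (PiYdd C) ⊥) (Additive.ofMul y)))
    (t₀ : Lbl) (g : P₀) {y : Lbl → O}
    (hy : (fun t => R t (h1LimKummerOn (phi C) (D.lDeltaTheta l) (PiYdd C) c hA hfi O (y t))) ∈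
      (((thetaEnvData C hC hS hl hp2 hpl hζ mods f hf hmods h15 L hZ hcharY hlim).toRecord
        (h1LimConjMulAut (phi C) (D.lDeltaTheta l) (PiYdd C)) (h1LimKummerOn (phi C) (D.lDeltaTheta l) (PiYdd C) c hA hfi O)
        iota).inftyThetaMonoid i).map
        (MonoidHom.pi R)) :
    ∃ v : Lbl → O, (∀ t, IsOfFinOrder (v t)) ∧
      (fun t => R t (h1LimKummerOn (phi C) (D.lDeltaTheta l) (PiYdd C) c hA hfi O
          (v t * ⟨(s t g) • ((y t : O) : A), hO (s t g) _ (y t).2⟩))) ∈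
        (((thetaEnvData C hC hS hl hp2 hpl hζ mods f hf hmods h15 L hZ hcharY hlim).toRecord
        (h1LimConjMulAut (phi C) (D.lDeltaTheta l) (PiYdd C)) (h1LimKummerOn (phi C) (D.lDeltaTheta l) (PiYdd C) c hA hfi O)
        iota).inftyThetaMonoid i).map
          (MonoidHom.pi R) := by
  obtain ⟨z, hz, hzy⟩ := hy
  -- Cor 3.5 (ii) at `∞Ψ^{i}_env` (abc-iut-w4-d004, any inversion family): synchronization up to an `n`-torsion family `u`
  obtain ⟨n, u, hn, hun, hsync⟩ :=
    pi_restriction_inftyThetaMonoid_upToTorsion_toRecord_act_of_mem_thetaEnv C hC hS hl hp2 hpl hζ mods f hf hmods h15 L hZ hcharY hlim c hA hfi O hO iota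
      φ₀ s hι hN hφAct q hq w hsec hθ i hroots R hR hz t₀ g
  -- each `u t` is the Kummer class of a root of unity `ζ t ∈ O` (abc-iut-w5-d098 + `hOtors`)
  have hv : ∀ t, ∃ ζ : A, IsOfFinOrder ζ ∧
      h1LimKummer (phi C) (D.lDeltaTheta l) (PiYdd C) c hA hfi ζ = u t := by
    intro t
    have hut₀ : IsOfFinOrder (u t) := isOfFinOrder_iff_pow_eq_one.mpr ⟨n, hn, hun t⟩
    have hut : IsOfFinAddOrder
        (Multiplicative.toAdd (α := h1Lim (phi C) (D.lDeltaTheta l) (PiYdd C) ⊥) (u t)) :=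
      (isOfFinOrder_ofAdd_iff (α := h1Lim (phi C) (D.lDeltaTheta l) (PiYdd C) ⊥)
        (x := Multiplicative.toAdd (α := h1Lim (phi C) (D.lDeltaTheta l) (PiYdd C) ⊥) (u t))).mp hut₀
    obtain ⟨ζr, hζr, hζreq⟩ :=
      exists_h1LimKummer_eq_of_isOfFinAddOrder (phi C) (D.lDeltaTheta l) (PiYdd C) c hA hfi hc _ hut
    exact ⟨ζr, hζr, hζreq⟩
  choose ζr hζr hζreq using hv
  refine ⟨fun t => ⟨ζr t, (hOtors (ζr t) (hζr t)).1⟩, fun t => ?_, ?_⟩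
  · obtain ⟨m, hm, hζm⟩ := (hζr t).exists_pow_eq_one
    exact isOfFinOrder_iff_pow_eq_one.mpr
      ⟨m, hm, Subtype.ext (by rw [SubmonoidClass.coe_pow, OneMemClass.coe_one]; exact hζm)⟩
  · -- the new tuple IS `∏ R_t (s_{t₀}(g) · z)`, and `s_{t₀}(g) · z ∈ ∞Ψ^{i}_env` (units stable, `hΘU`)
    have key : (fun t => R t (h1LimKummerOn (phi C) (D.lDeltaTheta l) (PiYdd C) c hA hfi O
        ((⟨ζr t, (hOtors (ζr t) (hζr t)).1⟩ : O) * ⟨(s t g) • ((y t : O) : A), hO (s t g) _ (y t).2⟩))) =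
        (fun t => R t (u t)) * piIso Lbl (h1LimConjMulAut φ₀ (D.lDeltaTheta l) ⊤ g)
          (fun t => R t (h1LimKummerOn (phi C) (D.lDeltaTheta l) (PiYdd C) c hA hfi O (y t))) := by
      funext t
      have hmul : R t (h1LimKummerOn (phi C) (D.lDeltaTheta l) (PiYdd C) c hA hfi O
          ((⟨ζr t, (hOtors (ζr t) (hζr t)).1⟩ : O) * ⟨(s t g) • ((y t : O) : A), hO (s t g) _ (y t).2⟩)) =
          R t (h1LimKummerOn (phi C) (D.lDeltaTheta l) (PiYdd C) c hA hfi O ⟨ζr t, (hOtors (ζr t) (hζr t)).1⟩) *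
          R t (h1LimKummerOn (phi C) (D.lDeltaTheta l) (PiYdd C) c hA hfi O
            ⟨(s t g) • ((y t : O) : A), hO (s t g) _ (y t).2⟩) :=
        (congrArg (R t) (map_mul (h1LimKummerOn (phi C) (D.lDeltaTheta l) (PiYdd C) c hA hfi O) _ _)).trans
          (map_mul (R t) _ _)
      have hκζ : R t (h1LimKummerOn (phi C) (D.lDeltaTheta l) (PiYdd C) c hA hfi O ⟨ζr t, (hOtors (ζr t) (hζr t)).1⟩) =
          R t (u t) := congrArg (R t) (hζreq t)
      change _ = R t (u t) * h1LimConjMulAut φ₀ (D.lDeltaTheta l) ⊤ g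
        (R t (h1LimKummerOn (phi C) (D.lDeltaTheta l) (PiYdd C) c hA hfi O (y t)))
      rw [hmul, hκζ,
        kummer_smul_restriction_eq_toRecord_act_family C hC hS hl hp2 hpl hζ mods f hf hmods h15 L hZ hcharY hlim c hA hfi O hO iota φ₀ s hι hN hφAct R hR t g (y t)]
    have hzstab : ((thetaEnvData C hC hS hl hp2 hpl hζ mods f hf hmods h15 L hZ hcharY hlim).toRecord
        (h1LimConjMulAut (phi C) (D.lDeltaTheta l) (PiYdd C)) (h1LimKummerOn (phi C) (D.lDeltaTheta l) (PiYdd C) c hA hfi O)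
        iota).conj
        (s t₀ g) z ∈
        ((thetaEnvData C hC hS hl hp2 hpl hζ mods f hf hmods h15 L hZ hcharY hlim).toRecord
        (h1LimConjMulAut (phi C) (D.lDeltaTheta l) (PiYdd C)) (h1LimKummerOn (phi C) (D.lDeltaTheta l) (PiYdd C) c hA hfi O)
        iota).inftyThetaMonoid i :=
      splitMonoid_closure_conjStable
        ((thetaEnvData C hC hS hl hp2 hpl hζ mods f hf hmods h15 L hZ hcharY hlim).toRecord
        (h1LimConjMulAut (phi C) (D.lDeltaTheta l) (PiYdd C)) (h1LimKummerOn (phi C) (D.lDeltaTheta l) (PiYdd C) c hA hfi O)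
        iota).conj
        ((thetaEnvData C hC hS hl hp2 hpl hζ mods f hf hmods h15 L hZ hcharY hlim).toRecord
        (h1LimConjMulAut (phi C) (D.lDeltaTheta l) (PiYdd C)) (h1LimKummerOn (phi C) (D.lDeltaTheta l) (PiYdd C) c hA hfi O)
        iota).units
        (((thetaEnvData C hC hS hl hp2 hpl hζ mods f hf hmods h15 L hZ hcharY hlim).toRecord
        (h1LimConjMulAut (phi C) (D.lDeltaTheta l) (PiYdd C)) (h1LimKummerOn (phi C) (D.lDeltaTheta l) (PiYdd C) c hA hfi O)
        iota).inftyThetaEnv i)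
        (s t₀ g)
        (fun u' hu' => units_stable_toRecord_family C hC hS hl hp2 hpl hζ mods f hf hmods h15 L hZ hcharY hlim c hA hfi O hO iota (s t₀ g) u' hu')
        (hThetaU_toRecord_family C hC hS hl hp2 hpl hζ mods f hf hmods h15 L hZ hcharY hlim c hA hfi O hO iota s hN hc hOtors hOroot hθ i hroots g t₀)
        z hz
    rw [key, ← hzy, ← hsync]
    exact ⟨_, hzstab, rfl⟩

end EtaleLevels

end Literature.IUT.HodgeArakelov

end
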